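import Literature.Analysis.FluidPDE.TransportGalerkinWeakForm
import Literature.Analysis.FluidPDE.TransportWeakExistence
import Literature.Analysis.FluidPDE.PassiveScalarEnergyProofs
import HarnessLib

/-!
# The Fourier–Galerkin scheme for the linear transport equation on `T^d`, V: existence of
  admissible weak transport solutions for bounded velocities weakly continuous into `L²`

Analysis/FluidPDE file concluding the Galerkin discharge programme for
`Torus.BardosTitiWiedemann2012_transportExistence` (`TransportWeakExistence`; Bardos–Titi–Wiedemann
2012, proof of Cor. 2; DiPerna–Lions 1989, Prop. II.1) in the case used by the printed proof of
Cor. 2 — velocities that are admissible weak Euler solutions, hence bounded, with `L²` slices,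
weakly divergence free and weakly continuous into `L²` on `[0,T]`:

* `transportExistence_of_weaklyContinuous` (**proved**): for `T > 0`, `b ∈ L^∞((0,T) × T^d)` with
  `b(t) ∈ L²`, `∫ ‖b(t)‖² ≤ B`, `div b(t) = 0` weakly on `[0,T]`, `t ↦ b(t)` weakly continuous into
  `L²` on `[0,T]`, and `w₀ ∈ L²`, there is `w` with `IsWeakScalarTransportOn T 0 b w₀ w`,
  `w(t) ∈ L²` and `‖w(t)‖_{L²} ≤ ‖w₀‖_{L²}` for every `t ∈ [0,T]`, `t ↦ w(t)` weakly continuous into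
  `L²` on `[0,T]`, and `w(0) = w₀` — i.e. the body of the named fact for such velocities
  (positive dimension). The velocity is clamped in time to `[0,T]` (`Set.projIcc`) to run the
  scheme on `[0,∞)`; the Galerkin limit of `TransportGalerkinLimit` solves the weak formulation by
  `IsGalerkinLimit.weak_eq` (`TransportGalerkinWeakForm`); its slice at `t = 0` is replaced by the
  datum, which changes nothing in the weak formulation and in the pairings
  (`IsGalerkinLimit.integral_zero_mul`: `∫ w(0) g = ∫ w₀ g`).

The general named fact (velocity merely `L^∞` in space–time, div-free for a.e. `t`) would in
addition require a time-regularisation of the velocity; it is not needed for Cor. 2 and is not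
attempted here.

## References

* C. Bardos, E. S. Titi, E. Wiedemann, C. R. Math. Acad. Sci. Paris 350 (2012) 757–760, proof of
  Cor. 2 (`BardosTitiWiedemann2012`).
* R. J. DiPerna, P.-L. Lions, Invent. Math. 98 (1989) 511–547, Prop. II.1, Cor. II.1
  (`DiPernaLions1989Invent`).
* C. De Lellis, L. Székelyhidi Jr., Arch. Ration. Mech. Anal. 195 (2010) 225–260, Lemma 7.1 and
  Lemma 2.2 (weak continuity in time) (`DeLellisSzekelyhidi2010`).
-/

open MeasureTheory Set Filter Topology Function UnitAddTorus Metric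
open scoped ENNReal NNReal InnerProductSpace ComplexConjugate

noncomputable section

namespace Literature.Analysis.FluidPDE

namespace Torus

open Literature.Analysis.FunctionSpaces.Torus Literature.Analysis.FunctionSpaces

variable {d : Type*} [Fintype d] [DecidableEq d]

/-! ## Conversions between Bochner and lower Lebesgue integrals of squares -/

section Conversions

omit [DecidableEq d] in
/-- `∫⁻ ‖f‖ₑ² = ofReal (∫ ‖f‖²)` for `f ∈ L²` (a local copy of the lemma of the same name in
`NSHopfEnergy`, not imported here to keep the import closure small). [folklore] -/
private theorem lintegral_enorm_sq_eq_ofReal' {E : Type*} [NormedAddCommGroup E] {f : UnitAddTorus d → E}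
    (hf : MemLp f 2 volume) : ∫⁻ x, ‖f x‖ₑ ^ 2 = ENNReal.ofReal (∫ x, ‖f x‖ ^ 2) := by
  rw [ofReal_integral_eq_lintegral_ofReal (hf.integrable_norm_pow two_ne_zero) (ae_of_all _ fun x => by positivity)]
  refine lintegral_congr_ae (ae_of_all _ fun x => ?_)
  show ‖f x‖ₑ ^ 2 = ENNReal.ofReal (‖f x‖ ^ 2)
  rw [ENNReal.ofReal_pow (norm_nonneg _), ofReal_norm]

omit [DecidableEq d] in
/-- `∫⁻ ‖f‖ₑ² = ofReal (∫ f²)` for a real `f ∈ L²`. [folklore] -/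
theorem lintegral_enorm_sq_eq_ofReal_sq {f : UnitAddTorus d → ℝ} (hf : MemLp f 2 volume) :
    ∫⁻ x, ‖f x‖ₑ ^ 2 = ENNReal.ofReal (∫ x, f x ^ 2) := by
  rw [lintegral_enorm_sq_eq_ofReal' hf]
  congr 1
  exact integral_congr_ae (ae_of_all _ fun x => by simp [sq_abs])

end Conversions

/-! ## Existence of admissible weak transport solutions for weakly continuous bounded velocities -/

section Existence

variable {b : ℝ → UnitAddTorus d → EuclideanSpace ℝ d} {B : ℝ} {w₀ : UnitAddTorus d → ℝ}
variable {hb : GalerkinVelocity b B} {hw₀ : MemLp w₀ 2 volume}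
variable {φ : ℕ → ℕ} {c : ℝ → (d → ℤ) → ℂ} {w : ℝ → UnitAddTorus d → ℝ}

/-- **The slice of a Galerkin limit at `t = 0` is the datum, weakly**: `∫ w(0) g = ∫ w₀ g` for all
`g ∈ L²` (`W_N(0) = P_N w₀ → w₀` strongly, and `⇀ w(0)` weakly). [folklore] -/
theorem IsGalerkinLimit.integral_zero_mul (h : IsGalerkinLimit hb hw₀ φ c w) {g : UnitAddTorus d → ℝ}
    (hg : MemLp g 2 volume) : ∫ x, w 0 x * g x = ∫ x, w₀ x * g x := by
  have h1 := h.tendsto_integral_mul le_rfl hg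
  have h2 : Tendsto (fun n => ∫ x, galerkinApprox hb w₀ (φ n) 0 x * g x) atTop (𝓝 (∫ x, w₀ x * g x)) := by
    simp_rw [galerkinApprox_zero]
    have hconv := (tendsto_integral_sq_sub_scalarTruncate hw₀).comp h.strictMono.tendsto_atTop
    refine tendsto_integral_mul_of_tendsto_integral_sq_sub (fun n => memLp_scalarTruncate _ _ 2) hw₀ ?_ hg
    refine hconv.congr fun n => integral_congr_ae (ae_of_all _ fun x => ?_)
    show (w₀ x - scalarTruncate (φ n) w₀ x) ^ 2 = (scalarTruncate (φ n) w₀ x - w₀ x) ^ 2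
    ring
  exact tendsto_nhds_unique h1 h2

/-- **Existence of admissible weak transport solutions on `T^d` for bounded velocities weakly
continuous into `L²`** (the conclusion of `Torus.BardosTitiWiedemann2012_transportExistence` under
the additional weak continuity in time of the velocity and pointwise-in-time hypotheses, which is
the case used by Bardos–Titi–Wiedemann 2012, proof of Cor. 2, where the velocity is an admissible
weak Euler solution of Székelyhidi 2011): for `T > 0`, `b ∈ L^∞((0,T) × T^d)` with `b(t) ∈ L²`,
`∫ ‖b(t)‖² ≤ B`, `div b(t) = 0` weakly for `t ∈ [0,T]` and `t ↦ b(t)` weakly continuous into `L²`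
on `[0,T]`, and `w₀ ∈ L²(T^d)`, there is a weak solution `w` of `∂ₜw + div (b w) = 0`, `w(0) = w₀`
in the DiPerna–Lions class (`IsWeakScalarTransportOn T 0 b w₀ w`) with `w(t) ∈ L²`,
`‖w(t)‖_{L²} ≤ ‖w₀‖_{L²}` for every `t ∈ [0,T]`, `t ↦ w(t)` weakly continuous into `L²` on `[0,T]`,
and `w(0) = w₀`. Proof: the Fourier–Galerkin scheme of `TransportGalerkin*` for the velocity
clamped in time to `[0,T]`, its Galerkin limit (positive dimension), the weak identity
`IsGalerkinLimit.weak_eq`, and the replacement of the slice `t = 0` by `w₀` (immaterial for the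
weak formulation, and `∫ w(0) g = ∫ w₀ g` anyway). [cite: BardosTitiWiedemann2012, proof of Cor. 2] -/
theorem transportExistence_of_weaklyContinuous [Nonempty d] {T : ℝ} (hT : 0 < T)
    {b : ℝ → UnitAddTorus d → EuclideanSpace ℝ d}
    (hbst : MemLp (stLift b) ∞ (volume.restrict (Ioo 0 T ×ˢ univ)))
    (hb2 : ∀ t ∈ Icc 0 T, MemLp (b t) 2 volume) {B : ℝ} (hB : ∀ t ∈ Icc 0 T, ∫ x, ‖b t x‖ ^ 2 ≤ B)
    (hbc : ∀ g : UnitAddTorus d → EuclideanSpace ℝ d, MemLp g 2 volume →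
      ContinuousOn (fun t => ∫ x, ⟪b t x, g x⟫_ℝ) (Icc 0 T))
    (hdiv : ∀ t ∈ Icc 0 T, FunctionSpaces.Torus.IsWeaklyDivFree (b t))
    {w₀ : UnitAddTorus d → ℝ} (hw₀ : MemLp w₀ 2 volume) :
    ∃ w : ℝ → UnitAddTorus d → ℝ,
      IsWeakScalarTransportOn T 0 b w₀ w ∧ (∀ t ∈ Icc 0 T, MemLp (w t) 2 volume) ∧
      (∀ t ∈ Icc 0 T, ∫⁻ x, ‖w t x‖ₑ ^ 2 ≤ ∫⁻ x, ‖w₀ x‖ₑ ^ 2) ∧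
      (∀ g : UnitAddTorus d → ℝ, MemLp g 2 volume → ContinuousOn (fun t => ∫ x, w t x * g x) (Icc 0 T)) ∧
      w 0 = w₀ := by
  -- the clamped velocity and its Galerkin structure
  -- (the clamp `t ↦ min (max t 0) T` onto `[0, T]` is Mathlib's `Set.projIcc 0 T _`)
  set bc : ℝ → UnitAddTorus d → EuclideanSpace ℝ d := fun t => b (Set.projIcc 0 T hT.le t : ℝ) with hbcdef
  have hcl_mem : ∀ t : ℝ, (Set.projIcc 0 T hT.le t : ℝ) ∈ Icc 0 T := fun t => (Set.projIcc 0 T hT.le t).2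
  have hbc_eq : ∀ t ∈ Icc 0 T, bc t = b t := fun t ht => by
    simp only [hbcdef, Set.projIcc_of_mem hT.le ht]
  have hGV : GalerkinVelocity bc B :=
    { memLp := fun t _ => hb2 _ (hcl_mem t)
      sq_le := fun t _ => hB _ (hcl_mem t)
      weaklyContinuous := fun T₀ g hg =>
        ((hbc g hg).comp_continuous (continuous_subtype_val.comp continuous_projIcc) hcl_mem).continuousOn
      divFree := fun t _ => hdiv _ (hcl_mem t) }
  obtain ⟨φ, c, w, h⟩ := exists_isGalerkinLimit hGV hw₀
  -- the a.e. velocity bound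
  obtain ⟨Bb, hBb0, hae⟩ := ae_ae_norm_le_of_memLp_top_stLift hbst
  have hbB : ∀ᵐ t, t ∈ Ioo 0 T → ∀ᵐ x, ‖bc t x‖ ≤ Bb := by
    rw [← ae_restrict_iff' measurableSet_Ioo]
    filter_upwards [hae, ae_restrict_mem measurableSet_Ioo] with t ht hmem
    rw [hbc_eq t (Ioo_subset_Icc_self hmem)]
    exact ht
  -- the solution: `w` with the slice `t = 0` replaced by the datum
  set w' : ℝ → UnitAddTorus d → ℝ := fun t => if t = 0 then w₀ else w t with hw'def
  have hw'0 : w' 0 = w₀ := by simp [hw'def]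
  have hw't : ∀ t, t ≠ 0 → w' t = w t := fun t ht => by simp [hw'def, ht]
  have hpair : ∀ t, 0 ≤ t → ∀ g : UnitAddTorus d → ℝ, MemLp g 2 volume → ∫ x, w' t x * g x = ∫ x, w t x * g x := by
    intro t ht g hg
    rcases eq_or_ne t 0 with h0 | h0
    · subst h0; rw [hw'0, h.integral_zero_mul hg]
    · rw [hw't t h0]
  have hmem' : ∀ t, 0 ≤ t → MemLp (w' t) 2 volume := by
    intro t ht
    rcases eq_or_ne t 0 with h0 | h0
    · subst h0; rwa [hw'0]
    · rw [hw't t h0]; exact h.memLp t ht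
  have hE' : ∀ t, 0 ≤ t → ∫⁻ x, ‖w' t x‖ₑ ^ 2 ≤ ∫⁻ x, ‖w₀ x‖ₑ ^ 2 := by
    intro t ht
    rcases eq_or_ne t 0 with h0 | h0
    · subst h0; rw [hw'0]
    · rw [hw't t h0, lintegral_enorm_sq_eq_ofReal_sq (h.memLp t ht), lintegral_enorm_sq_eq_ofReal_sq hw₀]
      exact ENNReal.ofReal_le_ofReal (h.integral_sq_le ht)
  refine ⟨w', ?_, fun t ht => hmem' t ht.1, fun t ht => hE' t ht.1, fun g hg => ?_, hw'0⟩
  swap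
  · -- weak continuity on `[0, T]`
    refine ((h.continuousOn_integral_mul hg).mono (fun t ht => ht.1 : Icc 0 T ⊆ Ici 0)).congr fun t ht => ?_
    exact hpair t ht.1 g hg
  -- the weak solution structure
  have hfin₀ : ∫⁻ x, ‖w₀ x‖ₑ ^ 2 < ⊤ := by
    rw [lintegral_enorm_sq_eq_ofReal_sq hw₀]; exact ENNReal.ofReal_lt_top
  have hbE : ∀ t ∈ Icc 0 T, ∫⁻ x, ‖b t x‖ₑ ^ 2 ≤ ENNReal.ofReal B := fun t ht => by
    rw [lintegral_enorm_sq_eq_ofReal' (hb2 t ht)]; exact ENNReal.ofReal_le_ofReal (hB t ht)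
  refine
    { aestronglyMeasurable := ?_
      aestronglyMeasurable_velocity := hbst.1
      ae_lintegral_sq_le := ?_
      lintegral_velocity_lt_top := ?_
      lintegral_mul_lt_top := ?_
      ae_isWeaklyDivFree := ?_
      weak_eq := ?_ }
  · -- measurability of the solution on `(0,T) × ℝ^d`
    have h1 : AEStronglyMeasurable (stLift w) (volume.restrict (Ioo 0 T ×ˢ (univ : Set (EuclideanSpace ℝ d)))) :=
      h.aestronglyMeasurable.mono_measure (Measure.restrict_mono (prod_mono Ioo_subset_Ioi_self subset_rfl) le_rfl)
    refine h1.congr ?_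
    filter_upwards [ae_restrict_mem (measurableSet_Ioo.prod MeasurableSet.univ)] with p hp
    simp only [stLift, hw't p.1 (ne_of_gt hp.1.1)]
  · -- `L^∞_t L²_x`
    refine ⟨(∫⁻ x, ‖w₀ x‖ₑ ^ 2).toNNReal, ?_⟩
    rw [ENNReal.coe_toNNReal hfin₀.ne]
    filter_upwards [ae_restrict_mem measurableSet_Ioo] with t ht
    exact hE' t ht.1.le
  · -- `b ∈ L¹_t L²_x`
    have hle : ∫⁻ t in Ioo 0 T, (∫⁻ x, ‖b t x‖ₑ ^ 2) ^ (1 / 2 : ℝ) ≤ ∫⁻ _ in Ioo 0 T, (ENNReal.ofReal B) ^ (1 / 2 : ℝ) := by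
      refine setLIntegral_mono' measurableSet_Ioo fun t ht => ?_
      exact ENNReal.rpow_le_rpow (hbE t (Ioo_subset_Icc_self ht)) (by norm_num)
    refine hle.trans_lt ?_
    rw [setLIntegral_const]
    exact ENNReal.mul_lt_top (ENNReal.rpow_lt_top_of_nonneg (by norm_num) ENNReal.ofReal_ne_top) measure_Ioo_lt_top
  · -- `b w ∈ L¹`
    have hle : ∫⁻ t in Ioo 0 T, ∫⁻ x, ‖b t x‖ₑ * ‖w' t x‖ₑ ≤ ∫⁻ _ in Ioo 0 T, (ENNReal.ofReal B + ∫⁻ x, ‖w₀ x‖ₑ ^ 2) := by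
      refine setLIntegral_mono' measurableSet_Ioo fun t ht => ?_
      have ht' : t ∈ Icc 0 T := Ioo_subset_Icc_self ht
      -- `a c ≤ a² + c²` in `ℝ≥0∞`
      have hmul : ∀ a c : ℝ≥0∞, a * c ≤ a ^ 2 + c ^ 2 := fun a c => by
        rcases le_total a c with h | h
        · calc a * c ≤ c * c := by gcongr
            _ = c ^ 2 := (sq c).symm
            _ ≤ a ^ 2 + c ^ 2 := le_add_self
        · calc a * c ≤ a * a := by gcongr
            _ = a ^ 2 := (sq a).symm
            _ ≤ a ^ 2 + c ^ 2 := le_self_add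
      calc ∫⁻ x, ‖b t x‖ₑ * ‖w' t x‖ₑ ≤ ∫⁻ x, (‖b t x‖ₑ ^ 2 + ‖w' t x‖ₑ ^ 2) :=
            lintegral_mono fun x => hmul _ _
        _ = (∫⁻ x, ‖b t x‖ₑ ^ 2) + ∫⁻ x, ‖w' t x‖ₑ ^ 2 :=
            lintegral_add_left' ((hb2 t ht').1.enorm.pow_const 2) _
        _ ≤ ENNReal.ofReal B + ∫⁻ x, ‖w₀ x‖ₑ ^ 2 := add_le_add (hbE t ht') (hE' t ht'.1)
    refine hle.trans_lt ?_
    rw [setLIntegral_const]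
    exact ENNReal.mul_lt_top (ENNReal.add_lt_top.2 ⟨ENNReal.ofReal_lt_top, hfin₀⟩) measure_Ioo_lt_top
  · -- weak incompressibility
    filter_upwards [ae_restrict_mem measurableSet_Ioo] with t ht
    exact hdiv t (Ioo_subset_Icc_self ht)
  · -- the weak formulation
    intro ψ hψ
    have hw := h.weak_eq hT hBb0 hbB hψ
    have hI : ∀ t ∈ Ioo 0 T, (∫ x, w' t x * (FunctionSpaces.Torus.timeDeriv ψ t x +
        ⟪b t x, FunctionSpaces.Torus.gradient (ψ t) x⟫_ℝ + 0 * FunctionSpaces.Torus.laplacian (ψ t) x)) =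
        ∫ x, w t x * (FunctionSpaces.Torus.timeDeriv ψ t x +
          ⟪bc t x, FunctionSpaces.Torus.gradient (ψ t) x⟫_ℝ + 0 * FunctionSpaces.Torus.laplacian (ψ t) x) := by
      intro t ht
      rw [hbc_eq t (Ioo_subset_Icc_self ht), hw't t (ne_of_gt ht.1)]
    rw [setIntegral_congr_fun (measurableSet_Ioo (a := (0 : ℝ)) (b := T)) hI]
    exact hw

end Existence

end Torus

end Literature.Analysis.FluidPDE

end
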